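import Summits.QuantumFields.YangMills.Theorems.UnitScaleTiltProp7LocMinOfGaugedRows
import Literature.MathematicalPhysics.QuantumFieldTheory.Balaban1983to89.B9Eq39Adjoint
import Literature.MathematicalPhysics.QuantumFieldTheory.Balaban1983to89.B9TorusCalculus
import Literature.MathematicalPhysics.QuantumFieldTheory.Balaban1983to89.B10Eq27TorusAxialLog
import HarnessLib

/-!
# Route `UnitScaleTilt`, crux K1 child «MinimiserStabilityRegPr» (stmt-QuantumFields-19200) — DOOR v4 OF THE E′ GROWTH SIDE:
# E′ ⇐ per competitor {CHART, HESS `κM ≤ K` (K-only), CRUDE SLICE `DIV ≤ ζK + δM` (any ζ, δ), JOINT MOD COARSE GAUGE `≤ C₁ℓ⁻¹M + C₂ℓ(K + DIV)`}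

Cell `ym3-torus` ∕ fleet seat `ym-ust-19200-p1` (gen 14, route-R lead ∕ (n3) namer).  THEOREMS ONLY (0 `def`, 0 `sorry`); `--supports stmt-QuantumFields-19200`, count-neutral.
YM₃ on T³ is a ladder rung (R3), not the Clay problem; nothing here claims the stub, the crux, d = 4 or the mass gap; E′ is NOT closed by this file.

WHY.  Located 2026-08-28 16:26Z (ym3-torus-px17) ∕ 16:29Z (this seat): the (116)-currency door ✓`Prop7LocMinOfGaugedRows116(Text)` folds its SLICE row into HESS and therefore
needs `δ₀ < 4κ_H ≈ 7·10⁻¹⁰` (L = 3), while the divergence of print's ([Balaban1985RegularSpaces] (1.38)) representative — re-gauged onto the untwisted fibre or not — is only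
`≤ C·ℓ⁻²M` with `C ≈ 30` sharp (LEMMA (S_blk-DIV)); print itself never budgets that coarse-harmonic divergence ([Balaban1985BackgroundPropagators] (3.118)–(3.122): the coercive
operator is `Δ_R + DRD* + Q*aQ`, Thm 3.11).  So the HESS row must stay in K-ONLY currency (`κM ≤ K`, supplier = relative∕pinned Poincaré on the fibre — route-R's registered stub P),
and the divergence budget is needed ONLY to fold the `(K + DIV)`-currency JOINT row of the (n3) suppliers (★w4's F5 `…JointRowOfSuppliers`) into `(M, K)`: there a crude slice
`DIV ≤ ζK + δM` with constants of any size suffices (`C₁′ = C₁ + C₂ℓ²δ`, `C₂′ = C₂(1+ζ)`; with `δ = δ₁ℓ⁻²` all windows are `L`-only).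

WHAT IS PROVED (ns `…Theorems.Prop7LocMinOfGaugedRowsKD`; T³, `SU(2)`).
* §1 ★★ `isMinOn_regFibrePr_of_gaugedRowsKD_at` — one member, one datum, rows {CHART, HESS K-only, CRUDE SLICE, JOINT mod coarse gauge in `(K + DIV)`} ⇒ `W` minimises over (6)(e) ∩ 𝔅_k(V)
  (= ✓`Prop7LocMinOfGaugedRows.isMinOn_regFibrePr_of_gaugedRows_at` after the fold).
* §2 ★★★ `stub_PV3E_of_gaugedRowsKD` — the E′ TEXT OF RECORD from ONE uniform hypothesis with `L`-only constants `e₆, s₀, κ₀, ζ, δ₁, C₁, C₂` (`s = s₀ℓ⁻¹`, `κ = κ₀ℓ⁻²`, `δ = δ₁ℓ⁻²`),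
  windows `10¹⁰L⁶e₆ ≤ 1`, `4s₀ ≤ 1`, `16e₆C₂(1+ζ) ≤ 1`, `15552s₀² + 216e₆ + 2e₆(C₁ + C₂δ₁) ≤ κ₀∕8`.
HONEST SCOPE.  Bookkeeping over landed letters.  DISPLAYED per competitor, not proved: CHART (with, for the (n3) supplier F5, the UNTWISTED membership — OWNER RULING g27-№8, files
✓`Prop7BlendPrescribed`, ✓`Prop7TwistRegauge`, ★w1-19200's corner data), HESS K-only (route-R's P ∕ (JC)), the crude slice (★routeR-w3's S_blk-DIV + the blend's Laplacian row), the
JOINT row (F5).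

References: T. Bałaban, CMP 102 (1985) 277–309 [Balaban1985Variational] ((6) p.278, (14) p.280, (47)–(48) pp.285–286, (116) p.295, (141)–(143), Prop. 7 p.299);
CMP 99 (1985) 389–434 [Balaban1985BackgroundPropagators] ((3.9)–(3.11) p.392, (3.118)–(3.122) pp.419–420, Thm 3.11 p.416); CMP 99 (1985) 75–102 [Balaban1985RegularSpaces] ((1.38) p.82).
-/

set_option autoImplicit false
noncomputable section

open scoped BigOperators Matrix.Norms.L2Operator Matrix Topology
open Filter

namespace Summit.QuantumFields.YangMills.Theorems.Prop7LocMinOfGaugedRowsKD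

open Literature.MathematicalPhysics.QuantumFieldTheory.Balaban1983to89
open Literature.MathematicalPhysics.QuantumFieldTheory.Balaban1983to89.T3ContinuumYM3Torus
open Literature.MathematicalPhysics.QuantumFieldTheory.Balaban1983to89.T3UnitLawDensityEML (ℰp)
open Literature.MathematicalPhysics.QuantumFieldTheory.Balaban1983to89.T3ConstrainedMinimiser
open Literature.MathematicalPhysics.QuantumFieldTheory.Balaban1983to89.T3Thm1Carrier
open Literature.MathematicalPhysics.QuantumFieldTheory.Balaban1983to89.T3PrintedRegularMinimiser
open Literature.MathematicalPhysics.QuantumFieldTheory.Balaban1983to89.T3RegularMinimiser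
open Literature.MathematicalPhysics.QuantumFieldTheory.Balaban1983to89.T3Thm1CarrierNative (IsCritR2)
open Literature.MathematicalPhysics.QuantumFieldTheory.Balaban1983to89.T3SectALandauChart (emb15 CloseAvg pos_of_regPr)
open T4Continuum BlockAveraging AveragingRT ExpMeanLog BlockAveragingEMLLinearised BlockAveragingEMLLinearisedBackground BlockAveragingEMLProp2
open Summit.QuantumFields.YangMills.Theorems.Prop7TPrint (expHermField)
open Summit.QuantumFields.YangMills.Theorems.Prop7LocMinOfJointRow (isMinOn_regFibrePr_of_linRows_at linRow_of_QRows)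
open Summit.QuantumFields.YangMills.Theorems.Prop7FirstVariationExactPairing (abs_lin_le_sum_norm_trueLinIter tower_loop_rows_of_regPr gaugeDir_mem_su2)
open Summit.QuantumFields.YangMills.Theorems.Prop7CurvedLandauRowA (exists_trueLinIter_family)
open Summit.QuantumFields.YangMills.Theorems.Prop7LocMinOfMultiplierRows (I_smul_mem_skewAdjoint trace_I_smul_eq_zero scaled_smallness_mult)
open Summit.QuantumFields.YangMills.Theorems.Prop7TrueLinPureGaugeIter (trueLinIter_sub trueLinIter_pureGauge)
open Summit.QuantumFields.YangMills.Theorems.Prop7LinGaugeInvariance (lin_sub_gaugeDir_eq)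
open Summit.QuantumFields.YangMills.Theorems.Prop7LocMinOfGaugedRows (abs_lin_le_sum_norm_trueLinIter_sub_coarseGauge isMinOn_regFibrePr_of_gaugedRows_at)
open B9Eq39Adjoint (divB)
open B9TorusCalculus (torusT)
open B10Eq27TorusAxialLog (unitsField toUField)
open B15DeterminingSets (embIter)
open B5Eq118OneStroke (iterBlockOf)
open Node00 (iterBlockOf_embIter_eq)

/-! ## §1 One member, one datum: door v4 -/

set_option maxHeartbeats 400000 in
/-- ★★ **E′ AT A DATUM — DOOR v4: HESS_W′ IN K-ONLY CURRENCY, A CRUDE SLICE BUDGET, THE JOINT ROW MOD COARSE GAUGE IN `(K + DIV)` CURRENCY.**  `W ∈ (6)(e) ∩ 𝔅_k(V)`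
R2-critical, `10¹⁰L⁶e ≤ 1`; `Q` any recursion family at `W` (displayed).  Per competitor `W′ ∈ (6)(e) ∩ 𝔅_k(V)`: a Hermitian-traceless `D`, `‖D(b)‖ ≤ s`, `A(W′) = A(e^{iD}W)`,
HESS `κM ≤ K` (K-ONLY: the right socket for an untwisted sup-small representative — pinned∕relative Poincaré on the fibre, route-R's P), a CRUDE slice `DIV ≤ ζK + δM` with `ζ, δ` of
ANY size (`DIV` = the (116) letter of ✓`hessW_curl_div_of_mem_fibre_T3`; ★routeR-w3's LEMMA (S_blk-DIV) ∕ px17's numerics: `δ ≍ 30·ℓ⁻²` is fine HERE), and the JOINT row mod coarse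
gauge `≤ C₁ℓ⁻¹M + C₂ℓ(K + DIV)` (= ★w4's F5 `jointRow_of_suppliers` output VERBATIM).  Windows `4s ≤ 1`, `2eC₂(1+ζ) ≤ ⅛`, `15552s² + 216·regThreshold(e) + 2e(C₁ + C₂ℓ²δ)ℓ⁻² ≤ κ∕8`
⇒ `W` minimises over (6)(e) ∩ 𝔅_k(V).  Proof: fold the slice into the JOINT row (`C₁′ = C₁ + C₂ℓ²δ`, `C₂′ = C₂(1+ζ)`) and apply ✓`Prop7LocMinOfGaugedRows.isMinOn_regFibrePr_of_gaugedRows_at`.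
(The (116)-currency door ✓`Prop7LocMinOfGaugedRows116` needs `δ < 4κ`, unconsumable for representatives with coarse-harmonic divergence — bus 2026-08-28 16:26Z∕16:29Z.)
[cite: Balaban1985Variational, (141)-(143) p.299, (116) p.295, (47)-(48) pp.285-286, (6) p.278; Balaban1985BackgroundPropagators, (3.9)-(3.11) p.392, (3.118)-(3.122) pp.419-420] -/
theorem isMinOn_regFibrePr_of_gaugedRowsKD_at (F : T3Family) {n K : ℕ} (h : n ≤ K) {e s κ ζ δ C₁ C₂ : ℝ} (hC₂ : 0 ≤ C₂)
    (V : GaugeField (F.P n) 0 (Matrix.specialUnitaryGroup (Fin 2) ℂ)) {W : GaugeField (F.P K) 0 (Matrix.specialUnitaryGroup (Fin 2) ℂ)}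
    (hW : IsCritR2 F n K h V W) (hWe : W ∈ regFibrePr F n K h e V) (he : 10 ^ 10 * (F.L : ℝ) ^ 6 * e ≤ 1)
    (Q : (k : ℕ) → (PBond (F.P K) 0 → Matrix (Fin 2) (Fin 2) ℂ) → PBond (F.P K) k → Matrix (Fin 2) (Fin 2) ℂ) (hQ0 : ∀ Y, Q 0 Y = Y)
    (hQs : ∀ (k : ℕ) (Y : PBond (F.P K) 0 → Matrix (Fin 2) (Fin 2) ℂ) (c : PBond (F.P K) (k + 1)), Q (k + 1) Y c
      = fderiv ℂ (eml : (Idx (F.P K) → Matrix (Fin 2) (Fin 2) ℂ) → Matrix (Fin 2) (Fin 2) ℂ)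
            (fun i => ((loopHol (Averaging.iter (fun i => blockAvg (P := F.P K) (j := i) (expMeanLogSU (n := Fin 2))) k W) c i :
              Matrix.specialUnitaryGroup (Fin 2) ℂ) : Matrix (Fin 2) (Fin 2) ℂ))
            (fun i => covWalkSum (Averaging.iter (fun i => blockAvg (P := F.P K) (j := i) (expMeanLogSU (n := Fin 2))) k W) (Q k Y)
                (walk (emb c.src) (loopWord (F.P K).L c.dir (off i.1) i.2.1 i.2.2))
              * ((loopHol (Averaging.iter (fun i => blockAvg (P := F.P K) (j := i) (expMeanLogSU (n := Fin 2))) k W) c i :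
                Matrix.specialUnitaryGroup (Fin 2) ℂ) : Matrix (Fin 2) (Fin 2) ℂ))
            * star ((corr (expMeanLogSU (n := Fin 2)) (Averaging.iter (fun i => blockAvg (P := F.P K) (j := i) (expMeanLogSU (n := Fin 2))) k W) c :
                Matrix.specialUnitaryGroup (Fin 2) ℂ) : Matrix (Fin 2) (Fin 2) ℂ)
          + ((corr (expMeanLogSU (n := Fin 2)) (Averaging.iter (fun i => blockAvg (P := F.P K) (j := i) (expMeanLogSU (n := Fin 2))) k W) c :
                Matrix.specialUnitaryGroup (Fin 2) ℂ) : Matrix (Fin 2) (Fin 2) ℂ)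
            * covWalkSum (Averaging.iter (fun i => blockAvg (P := F.P K) (j := i) (expMeanLogSU (n := Fin 2))) k W) (Q k Y)
                (walk (emb c.src) (List.replicate (F.P K).L (c.dir, true)))
            * star ((corr (expMeanLogSU (n := Fin 2)) (Averaging.iter (fun i => blockAvg (P := F.P K) (j := i) (expMeanLogSU (n := Fin 2))) k W) c :
                Matrix.specialUnitaryGroup (Fin 2) ℂ) : Matrix (Fin 2) (Fin 2) ℂ))
    (hrows : ∀ W' : GaugeField (F.P K) 0 (Matrix.specialUnitaryGroup (Fin 2) ℂ), W' ∈ regFibrePr F n K h e V →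
        ∃ (D : PBond (F.P K) 0 → Matrix (Fin 2) (Fin 2) ℂ),
          (∀ b : PBond (F.P K) 0, (D b).IsHermitian ∧ Matrix.trace (D b) = 0) ∧ (∀ b : PBond (F.P K) 0, ‖D b‖ ≤ s) ∧
          wilsonAction4 W' = wilsonAction4 (emb15 W (expHermField D)) ∧
          κ * ∑ b : PBond (F.P K) 0, ‖D b‖ ^ 2
            ≤ ∑ p : Plaq (F.P K) 0, ‖((Complex.I • D ⟨p.src, p.μ⟩) + ((W ⟨p.src, p.μ⟩ : Matrix (Fin 2) (Fin 2) ℂ) * (Complex.I • D ⟨p.src.shift p.μ, p.ν⟩) * star (W ⟨p.src, p.μ⟩ : Matrix (Fin 2) (Fin 2) ℂ))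
            - (((W ⟨p.src, p.μ⟩ * W ⟨p.src.shift p.μ, p.ν⟩ * (W ⟨p.src.shift p.ν, p.μ⟩)⁻¹ : Matrix.specialUnitaryGroup (Fin 2) ℂ) : Matrix (Fin 2) (Fin 2) ℂ) * (Complex.I • D ⟨p.src.shift p.ν, p.μ⟩) * star ((W ⟨p.src, p.μ⟩ * W ⟨p.src.shift p.μ, p.ν⟩ * (W ⟨p.src.shift p.ν, p.μ⟩)⁻¹ : Matrix.specialUnitaryGroup (Fin 2) ℂ) : Matrix (Fin 2) (Fin 2) ℂ))
            - (((GaugeField.plaqHol W p : Matrix.specialUnitaryGroup (Fin 2) ℂ) : Matrix (Fin 2) (Fin 2) ℂ) * (Complex.I • D ⟨p.src, p.ν⟩) * star ((GaugeField.plaqHol W p : Matrix.specialUnitaryGroup (Fin 2) ℂ) : Matrix (Fin 2) (Fin 2) ℂ)))‖ ^ 2 ∧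
          (∑ x : Site (F.P K) 0, ∑ j : Fin 2, ∑ k : Fin 2,
            ‖(divB (torusT (F.P K) 0) (fun κ z => unitsField (toUField W) ⟨z, κ⟩) (fun κ z => Complex.I • D ⟨z, κ⟩) x) j k‖ ^ 2)
            ≤ ζ * (∑ p : Plaq (F.P K) 0, ‖((Complex.I • D ⟨p.src, p.μ⟩) + ((W ⟨p.src, p.μ⟩ : Matrix (Fin 2) (Fin 2) ℂ) * (Complex.I • D ⟨p.src.shift p.μ, p.ν⟩) * star (W ⟨p.src, p.μ⟩ : Matrix (Fin 2) (Fin 2) ℂ))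
            - (((W ⟨p.src, p.μ⟩ * W ⟨p.src.shift p.μ, p.ν⟩ * (W ⟨p.src.shift p.ν, p.μ⟩)⁻¹ : Matrix.specialUnitaryGroup (Fin 2) ℂ) : Matrix (Fin 2) (Fin 2) ℂ) * (Complex.I • D ⟨p.src.shift p.ν, p.μ⟩) * star ((W ⟨p.src, p.μ⟩ * W ⟨p.src.shift p.μ, p.ν⟩ * (W ⟨p.src.shift p.ν, p.μ⟩)⁻¹ : Matrix.specialUnitaryGroup (Fin 2) ℂ) : Matrix (Fin 2) (Fin 2) ℂ))
            - (((GaugeField.plaqHol W p : Matrix.specialUnitaryGroup (Fin 2) ℂ) : Matrix (Fin 2) (Fin 2) ℂ) * (Complex.I • D ⟨p.src, p.ν⟩) * star ((GaugeField.plaqHol W p : Matrix.specialUnitaryGroup (Fin 2) ℂ) : Matrix (Fin 2) (Fin 2) ℂ)))‖ ^ 2)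
              + δ * ∑ b : PBond (F.P K) 0, ‖D b‖ ^ 2 ∧
          ∃ μ : Site (F.P K) (K - n) → Matrix (Fin 2) (Fin 2) ℂ, (∀ y, μ y ∈ skewAdjoint (Matrix (Fin 2) (Fin 2) ℂ) ∧ (μ y).trace = 0) ∧
          ∑ c : PBond (F.P K) (K - n), ‖Q (K - n) (fun b => Complex.I • D b) c
              - (μ c.src
                - ((Averaging.iter (fun i => blockAvg (P := F.P K) (j := i) (expMeanLogSU (n := Fin 2))) (K - n) W c : Matrix.specialUnitaryGroup (Fin 2) ℂ) :
                    Matrix (Fin 2) (Fin 2) ℂ) * μ c.tgt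
                  * star ((Averaging.iter (fun i => blockAvg (P := F.P K) (j := i) (expMeanLogSU (n := Fin 2))) (K - n) W c : Matrix.specialUnitaryGroup (Fin 2) ℂ) :
                    Matrix (Fin 2) (Fin 2) ℂ))‖
            ≤ C₁ * ((F.L : ℝ) ^ (K - n))⁻¹ * ∑ b : PBond (F.P K) 0, ‖D b‖ ^ 2
              + C₂ * (F.L : ℝ) ^ (K - n) * ((∑ p : Plaq (F.P K) 0, ‖((Complex.I • D ⟨p.src, p.μ⟩) + ((W ⟨p.src, p.μ⟩ : Matrix (Fin 2) (Fin 2) ℂ) * (Complex.I • D ⟨p.src.shift p.μ, p.ν⟩) * star (W ⟨p.src, p.μ⟩ : Matrix (Fin 2) (Fin 2) ℂ))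
            - (((W ⟨p.src, p.μ⟩ * W ⟨p.src.shift p.μ, p.ν⟩ * (W ⟨p.src.shift p.ν, p.μ⟩)⁻¹ : Matrix.specialUnitaryGroup (Fin 2) ℂ) : Matrix (Fin 2) (Fin 2) ℂ) * (Complex.I • D ⟨p.src.shift p.ν, p.μ⟩) * star ((W ⟨p.src, p.μ⟩ * W ⟨p.src.shift p.μ, p.ν⟩ * (W ⟨p.src.shift p.ν, p.μ⟩)⁻¹ : Matrix.specialUnitaryGroup (Fin 2) ℂ) : Matrix (Fin 2) (Fin 2) ℂ))
            - (((GaugeField.plaqHol W p : Matrix.specialUnitaryGroup (Fin 2) ℂ) : Matrix (Fin 2) (Fin 2) ℂ) * (Complex.I • D ⟨p.src, p.ν⟩) * star ((GaugeField.plaqHol W p : Matrix.specialUnitaryGroup (Fin 2) ℂ) : Matrix (Fin 2) (Fin 2) ℂ)))‖ ^ 2)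
                + (∑ x : Site (F.P K) 0, ∑ j : Fin 2, ∑ k : Fin 2,
            ‖(divB (torusT (F.P K) 0) (fun κ z => unitsField (toUField W) ⟨z, κ⟩) (fun κ z => Complex.I • D ⟨z, κ⟩) x) j k‖ ^ 2)))
    (hs4 : 4 * s ≤ 1) (hθ : 2 * e * (C₂ * (1 + ζ)) ≤ 1 / 8)
    (hsmall : 15552 * s ^ 2 + 216 * regThreshold F n K e + 2 * e * (C₁ + C₂ * ((F.L : ℝ) ^ (K - n)) ^ 2 * δ) * (((F.L : ℝ) ^ (K - n)) ^ 2)⁻¹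
      ≤ κ / 8) :
    IsMinOn (fun W' : GaugeField (F.P K) 0 (Matrix.specialUnitaryGroup (Fin 2) ℂ) => wilsonAction4 W') (regFibrePr F n K h e V) W := by
  refine isMinOn_regFibrePr_of_gaugedRows_at F h V hW hWe he Q hQ0 hQs (fun W' hW' => ?_) hs4 hθ hsmall
  obtain ⟨D, hDh, hDs, hA, hq, hsl, μ, hμ, hJ⟩ := hrows W' hW'
  -- fold the crude slice budget into the JOINT row: `C₁′ = C₁ + C₂ℓ²δ`, `C₂′ = C₂(1+ζ)`; HESS stays in K-only currency
  set ℓ : ℝ := (F.L : ℝ) ^ (K - n) with hℓ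
  have hL1 : (1 : ℝ) ≤ (F.L : ℝ) := by have := F.hL.2; exact_mod_cast (by omega : 1 ≤ F.L)
  have hℓ1 : 1 ≤ ℓ := one_le_pow₀ hL1
  have hℓ0 : 0 < ℓ := by linarith
  set Mm : ℝ := ∑ b : PBond (F.P K) 0, ‖D b‖ ^ 2 with hMm
  set Kc : ℝ := ∑ p : Plaq (F.P K) 0, ‖((Complex.I • D ⟨p.src, p.μ⟩) + ((W ⟨p.src, p.μ⟩ : Matrix (Fin 2) (Fin 2) ℂ) * (Complex.I • D ⟨p.src.shift p.μ, p.ν⟩) * star (W ⟨p.src, p.μ⟩ : Matrix (Fin 2) (Fin 2) ℂ))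
            - (((W ⟨p.src, p.μ⟩ * W ⟨p.src.shift p.μ, p.ν⟩ * (W ⟨p.src.shift p.ν, p.μ⟩)⁻¹ : Matrix.specialUnitaryGroup (Fin 2) ℂ) : Matrix (Fin 2) (Fin 2) ℂ) * (Complex.I • D ⟨p.src.shift p.ν, p.μ⟩) * star ((W ⟨p.src, p.μ⟩ * W ⟨p.src.shift p.μ, p.ν⟩ * (W ⟨p.src.shift p.ν, p.μ⟩)⁻¹ : Matrix.specialUnitaryGroup (Fin 2) ℂ) : Matrix (Fin 2) (Fin 2) ℂ))
            - (((GaugeField.plaqHol W p : Matrix.specialUnitaryGroup (Fin 2) ℂ) : Matrix (Fin 2) (Fin 2) ℂ) * (Complex.I • D ⟨p.src, p.ν⟩) * star ((GaugeField.plaqHol W p : Matrix.specialUnitaryGroup (Fin 2) ℂ) : Matrix (Fin 2) (Fin 2) ℂ)))‖ ^ 2 with hKc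
  set Dv : ℝ := ∑ x : Site (F.P K) 0, ∑ j : Fin 2, ∑ k : Fin 2,
            ‖(divB (torusT (F.P K) 0) (fun κ z => unitsField (toUField W) ⟨z, κ⟩) (fun κ z => Complex.I • D ⟨z, κ⟩) x) j k‖ ^ 2 with hDv
  have hMm0 : 0 ≤ Mm := Finset.sum_nonneg fun _ _ => sq_nonneg _
  have hKc0 : 0 ≤ Kc := Finset.sum_nonneg fun _ _ => sq_nonneg _
  have hJ' : ∑ c : PBond (F.P K) (K - n), ‖Q (K - n) (fun b => Complex.I • D b) c
              - (μ c.src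
                - ((Averaging.iter (fun i => blockAvg (P := F.P K) (j := i) (expMeanLogSU (n := Fin 2))) (K - n) W c : Matrix.specialUnitaryGroup (Fin 2) ℂ) :
                    Matrix (Fin 2) (Fin 2) ℂ) * μ c.tgt
                  * star ((Averaging.iter (fun i => blockAvg (P := F.P K) (j := i) (expMeanLogSU (n := Fin 2))) (K - n) W c : Matrix.specialUnitaryGroup (Fin 2) ℂ) :
                    Matrix (Fin 2) (Fin 2) ℂ))‖
      ≤ (C₁ + C₂ * ℓ ^ 2 * δ) * ℓ⁻¹ * Mm + C₂ * (1 + ζ) * ℓ * Kc := by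
    refine hJ.trans ?_
    have e1 : (C₁ + C₂ * ℓ ^ 2 * δ) * ℓ⁻¹ * Mm + C₂ * (1 + ζ) * ℓ * Kc
        = C₁ * ℓ⁻¹ * Mm + C₂ * ℓ * ((1 + ζ) * Kc + δ * Mm) := by
      field_simp
      ring
    rw [e1]
    have h2 : C₂ * ℓ * (Kc + Dv) ≤ C₂ * ℓ * ((1 + ζ) * Kc + δ * Mm) :=
      mul_le_mul_of_nonneg_left (by linarith [hsl]) (by positivity)
    linarith [h2]
  exact ⟨D, hDh, hDs, hA, hq, μ, hμ, hJ'⟩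

/-! ## §3 The E′ text of record with `L`-only constants, JOINT row modulo coarse gauge -/

set_option maxHeartbeats 400000 in
/-- ★★★ **ROW E′ ([Balaban1985Variational] (141)–(142) in print's regime) FROM DOOR v4's ROWS IN THEIR NATURAL SCALINGS.**  For every `L > 1` constants `e₆ > 0` (`10¹⁰L⁶e₆ ≤ 1`),
`s₀ ≥ 0` (`4s₀ ≤ 1`), `κ₀`, `ζ`, `δ₁, C₁, C₂ ≥ 0` (`16e₆C₂(1+ζ) ≤ 1`, `15552s₀² + 216e₆ + 2e₆(C₁ + C₂δ₁) ≤ κ₀∕8`) such that at every member, radius `0 < e ≤ e₆`, datum `V`, R2-critical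
`W ∈ (6)(e) ∩ 𝔅_k(V)`, recursion family `Q` at `W`, every competitor has a Hermitian-traceless `D` with `‖D b‖ ≤ s₀ℓ⁻¹`, `A(W′) = A(e^{iD}W)`, HESS `κ₀ℓ⁻²M ≤ K`, CRUDE SLICE
`DIV ≤ ζK + δ₁ℓ⁻²M` and JOINT mod coarse gauge `≤ C₁ℓ⁻¹M + C₂ℓ(K + DIV)`.  CONCLUSION = the E′ text verbatim (`e₅ := e₆`, `a₁'' := 1`).
[cite: Balaban1985Variational, (141)-(143) p.299, Prop. 7 p.299, (4)-(7) p.278, (14) p.280, (47)-(48) pp.285-286, (116) p.295; Balaban1985BackgroundPropagators, (3.9)-(3.11) p.392] -/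
theorem stub_PV3E_of_gaugedRowsKD
    (hrowsU : ∀ (L : ℕ), 1 < L → ∃ e₆ s₀ κ₀ ζ δ₁ C₁ C₂ : ℝ, 0 < e₆ ∧ 10 ^ 10 * (L : ℝ) ^ 6 * e₆ ≤ 1 ∧ 0 ≤ s₀ ∧ 4 * s₀ ≤ 1 ∧
      0 ≤ δ₁ ∧ 0 ≤ C₁ ∧ 0 ≤ C₂ ∧ 16 * e₆ * (C₂ * (1 + ζ)) ≤ 1 ∧
      15552 * s₀ ^ 2 + 216 * e₆ + 2 * e₆ * (C₁ + C₂ * δ₁) ≤ κ₀ / 8 ∧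
      ∀ (F : T3Family), F.L = L → ∀ (n K : ℕ) (hnK : n < K) (e : ℝ) (V : GaugeField (F.P n) 0 (Matrix.specialUnitaryGroup (Fin 2) ℂ))
        (W : GaugeField (F.P K) 0 (Matrix.specialUnitaryGroup (Fin 2) ℂ)),
        0 < e → e ≤ e₆ → W ∈ regFibrePr F n K hnK.le e V → IsCritR2 F n K hnK.le V W →
        ∀ (Q : (k : ℕ) → (PBond (F.P K) 0 → Matrix (Fin 2) (Fin 2) ℂ) → PBond (F.P K) k → Matrix (Fin 2) (Fin 2) ℂ), (∀ Y, Q 0 Y = Y) →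
        (∀ (k : ℕ) (Y : PBond (F.P K) 0 → Matrix (Fin 2) (Fin 2) ℂ) (c : PBond (F.P K) (k + 1)), Q (k + 1) Y c
          = fderiv ℂ (eml : (Idx (F.P K) → Matrix (Fin 2) (Fin 2) ℂ) → Matrix (Fin 2) (Fin 2) ℂ)
              (fun i => ((loopHol (Averaging.iter (fun i => blockAvg (P := F.P K) (j := i) (expMeanLogSU (n := Fin 2))) k W) c i :
                Matrix.specialUnitaryGroup (Fin 2) ℂ) : Matrix (Fin 2) (Fin 2) ℂ))
              (fun i => covWalkSum (Averaging.iter (fun i => blockAvg (P := F.P K) (j := i) (expMeanLogSU (n := Fin 2))) k W) (Q k Y)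
                  (walk (emb c.src) (loopWord (F.P K).L c.dir (off i.1) i.2.1 i.2.2))
                * ((loopHol (Averaging.iter (fun i => blockAvg (P := F.P K) (j := i) (expMeanLogSU (n := Fin 2))) k W) c i :
                  Matrix.specialUnitaryGroup (Fin 2) ℂ) : Matrix (Fin 2) (Fin 2) ℂ))
              * star ((corr (expMeanLogSU (n := Fin 2)) (Averaging.iter (fun i => blockAvg (P := F.P K) (j := i) (expMeanLogSU (n := Fin 2))) k W) c :
                  Matrix.specialUnitaryGroup (Fin 2) ℂ) : Matrix (Fin 2) (Fin 2) ℂ)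
            + ((corr (expMeanLogSU (n := Fin 2)) (Averaging.iter (fun i => blockAvg (P := F.P K) (j := i) (expMeanLogSU (n := Fin 2))) k W) c :
                  Matrix.specialUnitaryGroup (Fin 2) ℂ) : Matrix (Fin 2) (Fin 2) ℂ)
              * covWalkSum (Averaging.iter (fun i => blockAvg (P := F.P K) (j := i) (expMeanLogSU (n := Fin 2))) k W) (Q k Y)
                  (walk (emb c.src) (List.replicate (F.P K).L (c.dir, true)))
              * star ((corr (expMeanLogSU (n := Fin 2)) (Averaging.iter (fun i => blockAvg (P := F.P K) (j := i) (expMeanLogSU (n := Fin 2))) k W) c :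
                  Matrix.specialUnitaryGroup (Fin 2) ℂ) : Matrix (Fin 2) (Fin 2) ℂ)) →
        ∀ W' : GaugeField (F.P K) 0 (Matrix.specialUnitaryGroup (Fin 2) ℂ), W' ∈ regFibrePr F n K hnK.le e V →
          ∃ (D : PBond (F.P K) 0 → Matrix (Fin 2) (Fin 2) ℂ),
            (∀ b : PBond (F.P K) 0, (D b).IsHermitian ∧ Matrix.trace (D b) = 0) ∧ (∀ b : PBond (F.P K) 0, ‖D b‖ ≤ s₀ * ((F.L : ℝ) ^ (K - n))⁻¹) ∧
            wilsonAction4 W' = wilsonAction4 (emb15 W (expHermField D)) ∧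
            κ₀ * (((F.L : ℝ) ^ (K - n)) ^ 2)⁻¹ * ∑ b : PBond (F.P K) 0, ‖D b‖ ^ 2
              ≤ ∑ p : Plaq (F.P K) 0, ‖((Complex.I • D ⟨p.src, p.μ⟩) + ((W ⟨p.src, p.μ⟩ : Matrix (Fin 2) (Fin 2) ℂ) * (Complex.I • D ⟨p.src.shift p.μ, p.ν⟩) * star (W ⟨p.src, p.μ⟩ : Matrix (Fin 2) (Fin 2) ℂ))
            - (((W ⟨p.src, p.μ⟩ * W ⟨p.src.shift p.μ, p.ν⟩ * (W ⟨p.src.shift p.ν, p.μ⟩)⁻¹ : Matrix.specialUnitaryGroup (Fin 2) ℂ) : Matrix (Fin 2) (Fin 2) ℂ) * (Complex.I • D ⟨p.src.shift p.ν, p.μ⟩) * star ((W ⟨p.src, p.μ⟩ * W ⟨p.src.shift p.μ, p.ν⟩ * (W ⟨p.src.shift p.ν, p.μ⟩)⁻¹ : Matrix.specialUnitaryGroup (Fin 2) ℂ) : Matrix (Fin 2) (Fin 2) ℂ))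
            - (((GaugeField.plaqHol W p : Matrix.specialUnitaryGroup (Fin 2) ℂ) : Matrix (Fin 2) (Fin 2) ℂ) * (Complex.I • D ⟨p.src, p.ν⟩) * star ((GaugeField.plaqHol W p : Matrix.specialUnitaryGroup (Fin 2) ℂ) : Matrix (Fin 2) (Fin 2) ℂ)))‖ ^ 2 ∧
            (∑ x : Site (F.P K) 0, ∑ j : Fin 2, ∑ k : Fin 2,
            ‖(divB (torusT (F.P K) 0) (fun κ z => unitsField (toUField W) ⟨z, κ⟩) (fun κ z => Complex.I • D ⟨z, κ⟩) x) j k‖ ^ 2)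
              ≤ ζ * (∑ p : Plaq (F.P K) 0, ‖((Complex.I • D ⟨p.src, p.μ⟩) + ((W ⟨p.src, p.μ⟩ : Matrix (Fin 2) (Fin 2) ℂ) * (Complex.I • D ⟨p.src.shift p.μ, p.ν⟩) * star (W ⟨p.src, p.μ⟩ : Matrix (Fin 2) (Fin 2) ℂ))
            - (((W ⟨p.src, p.μ⟩ * W ⟨p.src.shift p.μ, p.ν⟩ * (W ⟨p.src.shift p.ν, p.μ⟩)⁻¹ : Matrix.specialUnitaryGroup (Fin 2) ℂ) : Matrix (Fin 2) (Fin 2) ℂ) * (Complex.I • D ⟨p.src.shift p.ν, p.μ⟩) * star ((W ⟨p.src, p.μ⟩ * W ⟨p.src.shift p.μ, p.ν⟩ * (W ⟨p.src.shift p.ν, p.μ⟩)⁻¹ : Matrix.specialUnitaryGroup (Fin 2) ℂ) : Matrix (Fin 2) (Fin 2) ℂ))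
            - (((GaugeField.plaqHol W p : Matrix.specialUnitaryGroup (Fin 2) ℂ) : Matrix (Fin 2) (Fin 2) ℂ) * (Complex.I • D ⟨p.src, p.ν⟩) * star ((GaugeField.plaqHol W p : Matrix.specialUnitaryGroup (Fin 2) ℂ) : Matrix (Fin 2) (Fin 2) ℂ)))‖ ^ 2)
                + δ₁ * (((F.L : ℝ) ^ (K - n)) ^ 2)⁻¹ * ∑ b : PBond (F.P K) 0, ‖D b‖ ^ 2 ∧
            ∃ μ : Site (F.P K) (K - n) → Matrix (Fin 2) (Fin 2) ℂ, (∀ y, μ y ∈ skewAdjoint (Matrix (Fin 2) (Fin 2) ℂ) ∧ (μ y).trace = 0) ∧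
            ∑ c : PBond (F.P K) (K - n), ‖Q (K - n) (fun b => Complex.I • D b) c
                - (μ c.src
                  - ((Averaging.iter (fun i => blockAvg (P := F.P K) (j := i) (expMeanLogSU (n := Fin 2))) (K - n) W c : Matrix.specialUnitaryGroup (Fin 2) ℂ) :
                      Matrix (Fin 2) (Fin 2) ℂ) * μ c.tgt
                    * star ((Averaging.iter (fun i => blockAvg (P := F.P K) (j := i) (expMeanLogSU (n := Fin 2))) (K - n) W c : Matrix.specialUnitaryGroup (Fin 2) ℂ) :
                      Matrix (Fin 2) (Fin 2) ℂ))‖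
              ≤ C₁ * ((F.L : ℝ) ^ (K - n))⁻¹ * ∑ b : PBond (F.P K) 0, ‖D b‖ ^ 2
                + C₂ * (F.L : ℝ) ^ (K - n) * ((∑ p : Plaq (F.P K) 0, ‖((Complex.I • D ⟨p.src, p.μ⟩) + ((W ⟨p.src, p.μ⟩ : Matrix (Fin 2) (Fin 2) ℂ) * (Complex.I • D ⟨p.src.shift p.μ, p.ν⟩) * star (W ⟨p.src, p.μ⟩ : Matrix (Fin 2) (Fin 2) ℂ))
            - (((W ⟨p.src, p.μ⟩ * W ⟨p.src.shift p.μ, p.ν⟩ * (W ⟨p.src.shift p.ν, p.μ⟩)⁻¹ : Matrix.specialUnitaryGroup (Fin 2) ℂ) : Matrix (Fin 2) (Fin 2) ℂ) * (Complex.I • D ⟨p.src.shift p.ν, p.μ⟩) * star ((W ⟨p.src, p.μ⟩ * W ⟨p.src.shift p.μ, p.ν⟩ * (W ⟨p.src.shift p.ν, p.μ⟩)⁻¹ : Matrix.specialUnitaryGroup (Fin 2) ℂ) : Matrix (Fin 2) (Fin 2) ℂ))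
            - (((GaugeField.plaqHol W p : Matrix.specialUnitaryGroup (Fin 2) ℂ) : Matrix (Fin 2) (Fin 2) ℂ) * (Complex.I • D ⟨p.src, p.ν⟩) * star ((GaugeField.plaqHol W p : Matrix.specialUnitaryGroup (Fin 2) ℂ) : Matrix (Fin 2) (Fin 2) ℂ)))‖ ^ 2)
                  + (∑ x : Site (F.P K) 0, ∑ j : Fin 2, ∑ k : Fin 2,
            ‖(divB (torusT (F.P K) 0) (fun κ z => unitsField (toUField W) ⟨z, κ⟩) (fun κ z => Complex.I • D ⟨z, κ⟩) x) j k‖ ^ 2))) :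
    ∀ (L : ℕ), 1 < L → ∀ (B₃ : ℝ), 4 < B₃ →
    ∃ e₅ a₁'' : ℝ, 0 < e₅ ∧ 0 < a₁'' ∧ ∀ (i : Idx L) (e ε₁ : ℝ) (V : GaugeField (i.1.1.P i.1.2.1) 0 (Matrix.specialUnitaryGroup (Fin 2) ℂ))
      (U₀ W : GaugeField (i.1.1.P i.1.2.2) 0 (Matrix.specialUnitaryGroup (Fin 2) ℂ)),
      0 < ε₁ → ε₁ ≤ a₁'' → PlaqSmall ε₁ V → (L : ℝ) ^ 3 * B₃ * ε₁ ≤ e → e ≤ e₅ →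
      RegPr i.1.1 i.1.2.1 i.1.2.2 ((L : ℝ) ^ 3 * B₃ * ε₁) U₀ → CloseAvg i.1.1 i.1.2.1 i.1.2.2 i.2.2.le ((L : ℝ) ^ 3 * ε₁) V U₀ →
      W ∈ regFibrePr i.1.1 i.1.2.1 i.1.2.2 i.2.2.le e V → IsCritR2 i.1.1 i.1.2.1 i.1.2.2 i.2.2.le V W →
        IsMinOn (fun W' : GaugeField (i.1.1.P i.1.2.2) 0 (Matrix.specialUnitaryGroup (Fin 2) ℂ) => wilsonAction4 W')
          (regFibrePr i.1.1 i.1.2.1 i.1.2.2 i.2.2.le e V) W := by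
  intro L hL B₃ hB₃
  obtain ⟨e₆, s₀, κ₀, ζ, δ₁, C₁, C₂, he₆, he₆L, hs₀, hs₀4, hδ₁, hC₁, hC₂, hC₂e, hsmall, H⟩ := hrowsU L hL
  refine ⟨e₆, 1, he₆, one_pos, ?_⟩
  intro i e ε₁ V U₀ W hε₁ _hε₁a _hV hlo hhi _hRU₀ _hclose hW hWcrit
  obtain ⟨⟨F, n, K⟩, hF, hnK⟩ := i
  have hL0 : (0 : ℝ) < (L : ℝ) := by exact_mod_cast (show 0 < L by omega)
  have he0 : 0 < e := lt_of_lt_of_le (by positivity) hlo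
  have hFL : (F.L : ℝ) = (L : ℝ) := by exact_mod_cast hF
  have hL1 : (1 : ℝ) ≤ (F.L : ℝ) := by have := F.hL.2; exact_mod_cast (by omega : 1 ≤ F.L)
  set ℓ : ℝ := (F.L : ℝ) ^ (K - n) with hℓ
  have hℓ1 : (1 : ℝ) ≤ ℓ := one_le_pow₀ hL1
  have hℓ0 : (0 : ℝ) < ℓ := by linarith
  -- the scaled radius `s = s₀ℓ⁻¹ ≤ s₀`: `4s ≤ 1`
  have hs4 : 4 * (s₀ * ℓ⁻¹) ≤ 1 := by
    have hi : ℓ⁻¹ ≤ 1 := inv_le_one_of_one_le₀ hℓ1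
    nlinarith [mul_le_mul_of_nonneg_left hi hs₀]
  -- the windows `10¹⁰L⁶e ≤ 1` and `2eC₂(1+ζ) ≤ ⅛` at this member
  have heL : 10 ^ 10 * (F.L : ℝ) ^ 6 * e ≤ 1 := by
    rw [hFL]
    have : 10 ^ 10 * (L : ℝ) ^ 6 * e ≤ 10 ^ 10 * (L : ℝ) ^ 6 * e₆ := mul_le_mul_of_nonneg_left hhi (by positivity)
    exact this.trans he₆L
  have hθ : 2 * e * (C₂ * (1 + ζ)) ≤ 1 / 8 := by
    by_cases hC₂' : 0 ≤ C₂ * (1 + ζ)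
    · nlinarith [mul_le_mul_of_nonneg_right hhi hC₂']
    · have hneg : C₂ * (1 + ζ) < 0 := lt_of_not_ge hC₂'
      nlinarith [he0.le]
  -- the datum smallness scaled by `ℓ⁻²` (`regThreshold(e) = eℓ⁻²`, `C₂ℓ²·(δ₁ℓ⁻²) = C₂δ₁`, `e ≤ e₆`)
  have hsmall' : 15552 * (s₀ * ℓ⁻¹) ^ 2 + 216 * regThreshold F n K e + 2 * e * (C₁ + C₂ * ℓ ^ 2 * (δ₁ * (ℓ ^ 2)⁻¹)) * (ℓ ^ 2)⁻¹
      ≤ κ₀ * (ℓ ^ 2)⁻¹ / 8 := by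
    have hthr : regThreshold F n K e = e * (ℓ ^ 2)⁻¹ := by
      unfold regThreshold
      rw [inv_pow, pow_mul', hℓ]
    rw [hthr]
    have hℓ2 : (0 : ℝ) < (ℓ ^ 2)⁻¹ := by positivity
    have hcd : 0 ≤ C₁ + C₂ * δ₁ := by positivity
    have hmono : 15552 * s₀ ^ 2 + 216 * e + 2 * e * (C₁ + C₂ * δ₁) ≤ κ₀ / 8 := by
      have h1 : 216 * e ≤ 216 * e₆ := by linarith
      have h2 : 2 * e * (C₁ + C₂ * δ₁) ≤ 2 * e₆ * (C₁ + C₂ * δ₁) := by nlinarith [mul_le_mul_of_nonneg_right hhi hcd]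
      linarith [hsmall]
    have key : 15552 * (s₀ * ℓ⁻¹) ^ 2 + 216 * (e * (ℓ ^ 2)⁻¹) + 2 * e * (C₁ + C₂ * ℓ ^ 2 * (δ₁ * (ℓ ^ 2)⁻¹)) * (ℓ ^ 2)⁻¹
        = (ℓ ^ 2)⁻¹ * (15552 * s₀ ^ 2 + 216 * e + 2 * e * (C₁ + C₂ * δ₁)) := by
      field_simp
    have key2 : κ₀ * (ℓ ^ 2)⁻¹ / 8 = (ℓ ^ 2)⁻¹ * (κ₀ / 8) := by ring
    rw [key, key2]
    exact mul_le_mul_of_nonneg_left hmono hℓ2.le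
  -- a recursion family at `W` (zero content) and the rows at it
  obtain ⟨Q, hQ0, hQs⟩ := exists_trueLinIter_family (N := 2) W
  exact isMinOn_regFibrePr_of_gaugedRowsKD_at F hnK.le hC₂ V hWcrit hW heL Q hQ0 hQs
    (H F hF n K hnK e V W he0 hhi hW hWcrit Q hQ0 hQs) hs4 hθ hsmall'

end Summit.QuantumFields.YangMills.Theorems.Prop7LocMinOfGaugedRowsKD

end
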